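import Mathlib.Analysis.Normed.Group.Tannery
import Literature.NumberTheory.LFunctions.WeilArchimedeanPositivityProofs
import Summits.RiemannHypothesis.RiemannHypothesis.Theorems.SpectralTraceWindowTraceArchStubBandlimitedTestAux
import HarnessLib

/-!
# The window identity for continuous band-limited tests (`stub_bandlimitedTest`)

Stub `stub_bandlimitedTest` of the line `defect-compactness-design` (wave 2: structure of
witnesses) for the crux `WindowTraceArch` (stmt-RiemannHypothesis-11195; skeleton
`Summit.RiemannHypothesis.RiemannHypothesis.Cruxes.WindowTraceArch.DefectCompactnessDesign`).

**Statement.** Let `γ : ι → ℝ` be a witness of the crux: `Σᵢ ĝ(1/2 + iγᵢ) = W(g)` (`HasSum`) for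
every Weil test `g` (smooth, compact support) with `tsupport g ⊆ [-log 2, log 2]`. Then the same
identity holds for every CONTINUOUS `g` supported in `[-log 2, log 2]` whose transform decays like
`|ĝ(1/2 + iu)| ≤ M/(1 + u²)` on the critical line. (This is the form in which the witness is tested
against the band-limited Beurling–Selberg functions in `stub_countingLaw`.)

**Proof.** Put `A = log 2` and `hₖ = φ̄ₖ ⋆ g(λₖ ·)` with `λₖ = 1 + 1/(k+1)` and `φ̄ₖ` a
normalised smooth bump of radius `rₖ = A/(2(k+1))`, so that `A/λₖ + rₖ ≤ A`: the `hₖ` are Weil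
tests supported in the window (`stub_bandlimitedTest_approx`), hence `Σᵢ ĥₖ(1/2 + iγᵢ) = W(hₖ)`.
Their transforms are `ĥₖ(s) = φ̄ₖ^(s) λₖ⁻¹ ĝ(1/2 + (s - 1/2)/λₖ)`, so `|ĥₖ(1/2 + iu)| ≤ 2M/(1 + u²)`
and `ĥₖ(s) → ĝ(s)` for every `s` (`φ̄ₖ^(s) → 1`, continuity of the entire function `ĝ`).
* Spectral side: `Σᵢ (1 + γᵢ²)⁻¹ < ∞` for a witness (`stub_bandlimitedTest_summable`, from the
  local Weyl law), so Tannery's theorem gives `W(hₖ) = Σᵢ ĥₖ(1/2 + iγᵢ) → Σᵢ ĝ(1/2 + iγᵢ)`.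
* Weil side: the prime terms of `hₖ` and `g` vanish on the window
  (`weilPrimeTerm_eq_zero_of_tsupport_subset`); `ĥₖ(0) → ĝ(0)`, `ĥₖ(1) → ĝ(1)`; the archimedean
  integrals converge by dominated convergence (`stub_bandlimitedTest_arch_tendsto`, majorant
  `2M (|C_ψ| + 2 log(1 + |t|))/(1/4 + t²)`); and `hₖ(0) → g(0)` (approximate identity). Hence
  `W(hₖ) → W(g)`.
By uniqueness of limits `Σᵢ ĝ(1/2 + iγᵢ) = W(g)`, and the series converges absolutely
(`|ĝ(1/2 + iγᵢ)| ≤ M (1 + γᵢ²)⁻¹`), so it is a `HasSum`.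

**Sources.** Standard real analysis (approximate identities, Tannery's theorem, dominated
convergence; e.g. E. M. Stein, R. Shakarchi, *Real Analysis* (2005), Ch. 2–3) on top of the tree's
Weil explicit-formula API. All ingredients are proved tree / Mathlib facts. [folklore]
-/

set_option linter.dupNamespace false

noncomputable section

open Complex Filter Set MeasureTheory
open scoped Real Topology BigOperators

namespace Summit.RiemannHypothesis.RiemannHypothesis.Theorems.SpectralTraceWindowTraceArch

open Literature.NumberTheory.LFunctions

/-- **stub_bandlimitedTest — the window identity for continuous band-limited tests.** If `γ` is a
witness then the identity `Σᵢ ĝ(½+iγᵢ) = W(g)` holds for every CONTINUOUS `g` supported in the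
closed window whose transform decays like `M/(1+u²)` on the critical line (not only for smooth
`g`). Proof: `g_k := φ̄_k ⋆ g(λ_k ·)` (dilate by `λ_k ↓ 1`, then mollify by a bump of radius
`< log 2 − (log 2)/λ_k`) are Weil tests in the window; `ĝ_k(½+iu) = λ_k⁻¹ ĝ(½+iu/λ_k) φ̂_k(u)`
(`weilMellin_weilConv_holds`, a change of variables), so `|ĝ_k(½+iu)| ≤ 2M/(1+u²)` and `ĝ_k → ĝ`
pointwise; `Σᵢ (1+γᵢ²)⁻¹ < ∞` for a witness (local Weyl law
`card_near_le_log_of_windowTraceArch_witness`), so Tannery gives `Σᵢ ĝ_k(½+iγᵢ) → Σᵢ ĝ(½+iγᵢ)`;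
on the Weil side `W(g_k) = ĝ_k(0) + ĝ_k(1) + (1/2π)∫ ĝ_k Re ψ − g_k(0) log π` (no prime term in
the window) converges to the same expression for `g` (dominated convergence with
`2M(|C_ψ| + 2 log(1+|u|))/(1/4+u²)`, and `g_k(0) → g(0)`), which IS `weilFunctional g`. [folklore] -/
theorem stub_bandlimitedTest :
    ∀ (ι : Type) (γ : ι → ℝ),
      (∀ g : ℝ → ℂ, Literature.NumberTheory.LFunctions.IsWeilTest g →
        tsupport g ⊆ Set.Icc (-Real.log 2) (Real.log 2) →
        HasSum (fun i => Literature.NumberTheory.LFunctions.weilMellin g (1 / 2 + (γ i : ℂ) * Complex.I))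
          (Literature.NumberTheory.LFunctions.weilFunctional g)) →
      ∀ (g : ℝ → ℂ) (M : ℝ), Continuous g → tsupport g ⊆ Set.Icc (-Real.log 2) (Real.log 2) →
        (∀ u : ℝ, ‖Literature.NumberTheory.LFunctions.weilMellin g (1 / 2 + (u : ℂ) * Complex.I)‖ ≤ M / (1 + u ^ 2)) →
        HasSum (fun i => Literature.NumberTheory.LFunctions.weilMellin g (1 / 2 + (γ i : ℂ) * Complex.I))
          (Literature.NumberTheory.LFunctions.weilFunctional g) := by
  intro ι γ hγ g M hg hgK hdec
  -- constants
  set A : ℝ := Real.log 2 with hA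
  have hA0 : 0 < A := Real.log_pos one_lt_two
  have hM0 : 0 ≤ M := by
    have h := (norm_nonneg _).trans (hdec 0)
    simpa using h
  have hgc : HasCompactSupport g :=
    isCompact_Icc.of_isClosed_subset (isClosed_tsupport g) hgK
  -- (1) summability over the witness
  have hsum : Summable fun i => (1 + γ i ^ 2)⁻¹ := stub_bandlimitedTest_summable ι γ hγ
  -- (2) the approximants `h k = φ̄_k ⋆ g(λ_k ·)`
  set e : ℕ → ℝ := fun k => 1 / ((k : ℝ) + 1) with he_def
  have he0 : ∀ k, 0 < e k := fun k => by
    show 0 < 1 / ((k : ℝ) + 1)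
    positivity
  have he1 : ∀ k, e k ≤ 1 := fun k => by
    show 1 / ((k : ℝ) + 1) ≤ 1
    rw [div_le_one (by positivity)]
    linarith [(k.cast_nonneg : (0 : ℝ) ≤ k)]
  have he : Tendsto e atTop (𝓝 0) := tendsto_one_div_add_atTop_nhds_zero_nat
  set lam : ℕ → ℝ := fun k => 1 + e k with hlam_def
  set r : ℕ → ℝ := fun k => A * e k / 2 with hr_def
  have hlam1 : ∀ k, 1 ≤ lam k := fun k => by
    show 1 ≤ 1 + e k
    linarith [he0 k]
  have hlam2 : ∀ k, lam k ≤ 2 := fun k => by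
    show 1 + e k ≤ 2
    linarith [he1 k]
  have hr0 : ∀ k, 0 < r k := fun k => by
    show 0 < A * e k / 2
    have := he0 k
    positivity
  have hfit : ∀ k, A / lam k + (r k) ≤ A := fun k => by
    show A / (1 + e k) + A * e k / 2 ≤ A
    have hek0 := he0 k
    have hek1 := he1 k
    have key : A / (1 + e k) ≤ A - A * e k / 2 := by
      rw [div_le_iff₀ (by linarith)]
      nlinarith [mul_nonneg (mul_nonneg hA0.le hek0.le) (sub_nonneg.2 hek1)]
    linarith
  have hlam : Tendsto lam atTop (𝓝 1) := by
    have h := (tendsto_const_nhds (x := (1 : ℝ))).add he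
    simpa using h
  have hr : Tendsto r atTop (𝓝 0) := by
    have h := (he.const_mul A).div_const 2
    simpa using h
  set φ : ℕ → ContDiffBump (0 : ℝ) := fun k =>
    ⟨r k / 2, r k, half_pos (hr0 k), half_lt_self (hr0 k)⟩ with hφ_def
  have hφ : Tendsto (fun k => (φ k).rOut) atTop (𝓝 0) := hr
  set h : ℕ → ℝ → ℂ := fun k =>
    weilConv (fun t => (((φ k).normed volume t : ℝ) : ℂ)) (fun t => g (lam k * t)) with hh_def
  have happ := fun k => stub_bandlimitedTest_approx hg hgK (hlam1 k) (φ k) (hfit k)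
  have hw : ∀ k, IsWeilTest (h k) := fun k => (happ k).1
  have hs : ∀ k, tsupport (h k) ⊆ Icc (-A) A := fun k => (happ k).2.1
  have hm : ∀ (k : ℕ) (s : ℂ), weilMellin (h k) s =
      weilMellin (fun t => (((φ k).normed volume t : ℝ) : ℂ)) s *
        (((lam k : ℝ) : ℂ)⁻¹ * weilMellin g (1 / 2 + (s - 1 / 2) / ((lam k : ℝ) : ℂ))) :=
    fun k s => (happ k).2.2 s
  -- transform bound on the critical line
  have hbd : ∀ (k : ℕ) (u : ℝ), ‖weilMellin (h k) (1 / 2 + u * I)‖ ≤ 2 * M * (1 + u ^ 2)⁻¹ := by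
    intro k u
    have hl0 : 0 < lam k := by linarith [hlam1 k]
    rw [hm k, norm_mul, norm_mul, norm_inv, Complex.norm_real, Real.norm_of_nonneg hl0.le]
    have hX : ‖weilMellin (fun t => (((φ k).normed volume t : ℝ) : ℂ)) (1 / 2 + u * I)‖ ≤ 1 :=
      stub_bandlimitedTest_bump_norm_le (φ k) u
    have h2 : weilMellin g (1 / 2 + (1 / 2 + u * I - 1 / 2) / ((lam k : ℝ) : ℂ)) =
        weilMellin g (1 / 2 + ((u / lam k : ℝ) : ℂ) * I) := by
      congr 1
      push_cast
      ring
    rw [h2]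
    have hY : ‖weilMellin g (1 / 2 + ((u / lam k : ℝ) : ℂ) * I)‖ ≤ M / (1 + (u / lam k) ^ 2) :=
      hdec _
    have hZ : (lam k)⁻¹ * (M / (1 + (u / lam k) ^ 2)) ≤ 2 * M * (1 + u ^ 2)⁻¹ := by
      have e1 : (lam k)⁻¹ * (M / (1 + (u / lam k) ^ 2)) = lam k * M / (lam k ^ 2 + u ^ 2) := by
        field_simp
      rw [e1, ← div_eq_mul_inv, div_le_div_iff₀ (by positivity) (by positivity)]
      nlinarith [mul_nonneg (mul_nonneg hM0 hl0.le) (by linarith [hlam1 k] : (0 : ℝ) ≤ 2 * lam k - 1),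
        mul_nonneg (mul_nonneg hM0 (sq_nonneg u)) (by linarith [hlam2 k] : (0 : ℝ) ≤ 2 - lam k)]
    calc _ ≤ 1 * ((lam k)⁻¹ * (M / (1 + (u / lam k) ^ 2))) :=
          mul_le_mul hX (mul_le_mul_of_nonneg_left hY (by positivity)) (by positivity) zero_le_one
      _ ≤ 2 * M * (1 + u ^ 2)⁻¹ := by rw [one_mul]; exact hZ
  -- pointwise convergence of the transforms, at every `s`
  have hpt : ∀ s : ℂ, Tendsto (fun k => weilMellin (h k) s) atTop (𝓝 (weilMellin g s)) := by
    intro s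
    have t1 : Tendsto (fun k => weilMellin (fun t => (((φ k).normed volume t : ℝ) : ℂ)) s)
        atTop (𝓝 1) := stub_bandlimitedTest_bump_tendsto hφ s
    have tl : Tendsto (fun k => ((lam k : ℝ) : ℂ)) atTop (𝓝 1) := by
      have h := (Complex.continuous_ofReal.tendsto 1).comp hlam
      simpa [Function.comp_def] using h
    have t2 : Tendsto (fun k => ((lam k : ℝ) : ℂ)⁻¹) atTop (𝓝 1) := by
      simpa using tl.inv₀ one_ne_zero
    have t3 : Tendsto (fun k => weilMellin g (1 / 2 + (s - 1 / 2) / ((lam k : ℝ) : ℂ))) atTop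
        (𝓝 (weilMellin g s)) := by
      have targ : Tendsto (fun k => (1 / 2 : ℂ) + (s - 1 / 2) / ((lam k : ℝ) : ℂ)) atTop (𝓝 s) := by
        have h2 := (tendsto_const_nhds (x := (1 / 2 : ℂ))).add
          ((tendsto_const_nhds (x := s - 1 / 2)).div tl one_ne_zero)
        simpa using h2
      exact ((continuous_weilMellin hg hgc).tendsto s).comp targ
    have h4 := t1.mul (t2.mul t3)
    simp only [one_mul] at h4
    exact h4.congr fun k => (hm k s).symm
  -- exactness of the witness on every approximant
  have hex : ∀ k, HasSum (fun i => weilMellin (h k) (1 / 2 + (γ i : ℂ) * I))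
      (weilFunctional (h k)) := fun k => hγ (h k) (hw k) (hs k)
  -- (3) the spectral side: Tannery's theorem
  have hT : Tendsto (fun k => weilFunctional (h k)) atTop
      (𝓝 (∑' i, weilMellin g (1 / 2 + (γ i : ℂ) * I))) := by
    have h1 : Tendsto (fun k => ∑' i, weilMellin (h k) (1 / 2 + (γ i : ℂ) * I)) atTop
        (𝓝 (∑' i, weilMellin g (1 / 2 + (γ i : ℂ) * I))) :=
      tendsto_tsum_of_dominated_convergence (hsum.mul_left (2 * M)) (fun i => hpt _)
        (Eventually.of_forall fun k i => hbd k (γ i))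
    exact h1.congr fun k => (hex k).tsum_eq
  -- (4) the Weil side
  have harch : Tendsto (fun k => weilArchIntegral (h k)) atTop (𝓝 (weilArchIntegral g)) :=
    stub_bandlimitedTest_arch_tendsto (F := h) (fun k => (hw k).1.continuous) (fun k => (hw k).2)
      hbd (fun t => hpt _)
  have h0 : Tendsto (fun k => h k 0) atTop (𝓝 (g 0)) :=
    stub_bandlimitedTest_value_tendsto (φ := φ) (c := lam) hg hlam hφ
  have hprk : ∀ k, weilPrimeTerm (h k) = 0 := fun k =>
    weilPrimeTerm_eq_zero_of_tsupport_subset (hw k).1.continuous (hs k)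
  have hprg : weilPrimeTerm g = 0 := weilPrimeTerm_eq_zero_of_tsupport_subset hg hgK
  have hW : Tendsto (fun k => weilFunctional (h k)) atTop (𝓝 (weilFunctional g)) := by
    have hlim := (((hpt 0).add (hpt 1)).sub (tendsto_const_nhds (x := (0 : ℂ)))).add
      ((harch.const_mul (1 / (2 * π) : ℂ)).sub (h0.mul_const (Real.log π : ℂ)))
    have e1 : ∀ k, weilFunctional (h k) = weilMellin (h k) 0 + weilMellin (h k) 1 - 0 +
        ((1 / (2 * π) : ℂ) * weilArchIntegral (h k) - h k 0 * (Real.log π : ℂ)) := by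
      intro k
      rw [weilFunctional, weilPolarTerm, weilArchTerm, hprk k]
    have e2 : weilFunctional g = weilMellin g 0 + weilMellin g 1 - 0 +
        ((1 / (2 * π) : ℂ) * weilArchIntegral g - g 0 * (Real.log π : ℂ)) := by
      rw [weilFunctional, weilPolarTerm, weilArchTerm, hprg]
    rw [e2]
    exact hlim.congr fun k => (e1 k).symm
  -- conclusion: the two limits agree, and the limit series converges absolutely
  have heq : ∑' i, weilMellin g (1 / 2 + (γ i : ℂ) * I) = weilFunctional g :=
    tendsto_nhds_unique hT hW
  have hgs : Summable fun i => weilMellin g (1 / 2 + (γ i : ℂ) * I) :=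
    Summable.of_norm_bounded (hsum.mul_left M) fun i => by
      rw [← div_eq_mul_inv]
      exact hdec (γ i)
  rw [← heq]
  exact hgs.hasSum

end Summit.RiemannHypothesis.RiemannHypothesis.Theorems.SpectralTraceWindowTraceArch

end
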